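import Summits.AtomisticToContinuum.HydrodynamicLimit.Theorems.JParityClosureLocalSecondLawEquilibriumTimeAverageMeasurable
import Summits.AtomisticToContinuum.HydrodynamicLimit.Theorems.JParityClosureLocalSecondLawEquilibriumDetIdentity
import Summits.AtomisticToContinuum.HydrodynamicLimit.Theorems.LocalSecondLaw.Negative.TimeIntegral

/-!
# Equilibrium stub `eq_timeAverage`, part 2 (lead c3): the pointwise bound and Tonelli + invariance

Equilibrium side-composition of line `exact-entropy-ledger-three-passivities` for the crux `JParityClosure.LocalSecondLaw`
(stmt-AtomisticToContinuum-13081).  RESHAPED form of the registered stub (the lead owns the composition): for every `N` and flow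
there is a MEASURABLE majorant `g` of `|Ĩ − I_det|` (almost surely under the homogeneous law) whose expectation is at most the
space–time integral of the STATIC `L¹` distances `E|X̃(s,·,x) − X_det(s,x)|`:
* pointwise (`ofReal_abs_sub_integral_le`, twice): `|∫f − ∫g| ≤ ∫⁻|f − g|` needs only a.e.-strong measurability of `f` and
  integrability of `g` (if `f` is not integrable the right side is infinite); `x ↦ X̃` and `s ↦ ∫ₓX̃` are measurable along a good
  orbit (part 1 + `measurable_flow_section`, `StronglyMeasurable.integral_prod_right'`), `X_det` is smooth;
* `g z := ∫⁻ₛ∫⁻ₓ |X̃ − X_det|(s, flowReg Φ (z,s), x)` is measurable (`measurable_flowReg`, `Measurable.lintegral_prod_right'`), and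
  Tonelli twice plus flow-invariance of the homogeneous law at each fixed `(s, x)` (`lintegral_comp_flow_localGibbsLaw_const`)
  evaluate `E[g]` as the static triple integral.

References: H. Spohn, *Large Scale Dynamics of Interacting Particles* (1991), Part I §2.3 (invariance of the homogeneous Gibbs law).
-/

noncomputable section

namespace Summit.AtomisticToContinuum.HydrodynamicLimit.Theorems.LocalSecondLawEquilibrium

open scoped BigOperators Topology Classical MeasureTheory ENNReal InnerProductSpace
open Filter Set MeasureTheory
open Literature.MathematicalPhysics.KineticTheory
open Literature.Analysis.FluidPDE
open Literature.Analysis.FunctionSpaces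
open Summit.AtomisticToContinuum.HydrodynamicLimit.Theorems.LocalSecondLawNegative
open Summit.AtomisticToContinuum.HydrodynamicLimit.Theorems.LocalSecondLawLedger
open Summit.AtomisticToContinuum.HydrodynamicLimit.Theorems.LocalSecondLawLedger.L

namespace TimeAvg

variable {N : ℕ}

/-- **`|∫f − ∫g| ≤ ∫⁻|f − g|`** for an a.e.-strongly measurable `f` and an integrable `g` (Bochner integrals, real-valued): if `f`
is integrable this is `|∫(f−g)| ≤ ∫|f−g|`; otherwise `∫⁻‖f‖ = ∞` forces `∫⁻|f−g| = ∞`. -/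
theorem ofReal_abs_sub_integral_le {α : Type*} [MeasurableSpace α] {μ : Measure α} {f g : α → ℝ}
    (hf : AEStronglyMeasurable f μ) (hg : Integrable g μ) :
    ENNReal.ofReal |∫ a, f a ∂μ - ∫ a, g a ∂μ| ≤ ∫⁻ a, ENNReal.ofReal |f a - g a| ∂μ := by
  by_cases hfi : Integrable f μ
  · rw [← integral_sub hfi hg]
    calc ENNReal.ofReal |∫ a, (f a - g a) ∂μ| ≤ ENNReal.ofReal (∫ a, |f a - g a| ∂μ) :=
          ENNReal.ofReal_le_ofReal (abs_integral_le_integral_abs (f := fun a => f a - g a))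
      _ = ∫⁻ a, ENNReal.ofReal |f a - g a| ∂μ :=
          ofReal_integral_eq_lintegral_ofReal (hfi.sub hg).abs (Eventually.of_forall fun a => abs_nonneg _)
  · -- `f` is not integrable: the right-hand side is infinite
    have hinf : ∫⁻ a, ‖f a‖ₑ ∂μ = ∞ := by
      by_contra h
      exact hfi ⟨hf, lt_top_iff_ne_top.2 h⟩
    have htop : ∫⁻ a, ENNReal.ofReal |f a - g a| ∂μ = ∞ := by
      have hle : ∫⁻ a, ‖f a‖ₑ ∂μ ≤ ∫⁻ a, ENNReal.ofReal |f a - g a| ∂μ + ∫⁻ a, ‖g a‖ₑ ∂μ := by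
        rw [← lintegral_add_right' _ hg.1.aemeasurable.enorm]
        refine lintegral_mono fun a => ?_
        rw [Real.enorm_eq_ofReal_abs, Real.enorm_eq_ofReal_abs, ← ENNReal.ofReal_add (abs_nonneg _) (abs_nonneg _)]
        exact ENNReal.ofReal_le_ofReal (by
          calc |f a| = |(f a - g a) + g a| := by ring_nf
            _ ≤ |f a - g a| + |g a| := abs_add_le _ _)
      rw [hinf] at hle
      by_contra hne
      have hfin : ∫⁻ a, ENNReal.ofReal |f a - g a| ∂μ + ∫⁻ a, ‖g a‖ₑ ∂μ < ∞ :=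
        ENNReal.add_lt_top.2 ⟨lt_top_iff_ne_top.2 hne, hg.2⟩
      exact absurd (top_le_iff.1 hle) hfin.ne
    rw [htop]; exact le_top

/-- The deterministic space integrand is integrable over the torus at every time (smooth test function). -/
theorem integrable_Xdet (σ Θ : ℝ) (ū : V3) {φ : ℝ → T3 → ℝ} (hφ : Torus.IsSmoothSpaceTimeOn Set.univ φ) (s : ℝ) :
    Integrable fun x : T3 => Xdet σ Θ ū φ s x := by
  have hsl : Torus.IsSmooth (φ s) := hφ.isSmooth_slice (Set.mem_univ s)
  have htd : Torus.IsSmooth (Torus.timeDerivWithin Set.univ φ s) :=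
    hφ.isSmooth_timeDerivWithin uniqueDiffOn_univ (Set.mem_univ s)
  have hAeq : (fun x : T3 => deriv (fun s' => φ s' x) s) = Torus.timeDerivWithin Set.univ φ s := by
    funext x; simp [Torus.timeDerivWithin, derivWithin_univ]
  have hA : Integrable (fun x : T3 => deriv (fun s' => φ s' x) s) := by rw [hAeq]; exact htd.integrable
  have hB : ∀ k : Fin 3, Integrable (fun x : T3 => ū k * pD k (φ s) x) := fun k =>
    (hsl.partialDeriv k).integrable.const_mul (ū k)
  unfold Xdet
  exact (hA.add (integrable_finsetSum _ fun k _ => hB k)).const_mul _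

/-- The deterministic space integral is a continuous function of time. -/
theorem continuous_integral_Xdet (σ Θ : ℝ) (ū : V3) {φ : ℝ → T3 → ℝ} (hφ : Torus.IsSmoothSpaceTimeOn Set.univ φ) :
    Continuous fun s : ℝ => ∫ x : T3, Xdet σ Θ ū φ s x := by
  have h : (fun s : ℝ => ∫ x : T3, Xdet σ Θ ū φ s x) =
      fun s => Hs σ 1 Θ * ∫ x : T3, Torus.timeDerivWithin Set.univ φ s x := by
    funext s; unfold Xdet; exact integral_detIntegrand_eq (Hs σ 1 Θ) ū hφ s
  rw [h]
  have hc := (hφ.timeDerivWithin uniqueDiffOn_univ).continuousOn_integral convex_univ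
  exact continuous_const.mul (continuousOn_univ.1 hc)

/-- **The pointwise bound along a good orbit**: `|Ĩ(z) − I_det| ≤ ∫⁻ₛ∫⁻ₓ |X̃(s, Φₛz, x) − X_det(s, x)|`. -/
theorem ofReal_abs_Itil_sub_Idet_le {η₀ σ r Θ τ : ℝ} {F : ℝ → ℝ} (ū : V3) (hE : EosBand η₀ F) (hσ : 0 < σ)
    (hσ3 : 3 * σ ^ 3 < η₀) (hr : 0 < r) {φ : ℝ → T3 → ℝ} (hφ : Torus.IsSmoothSpaceTimeOn Set.univ φ)
    (Φ : Flow σ N) {z : Phase N} (hz : z ∈ Φ.good) :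
    ENNReal.ofReal |Itil σ r τ φ Φ z - Idet σ Θ ū τ φ| ≤
      ∫⁻ s in Set.Icc (0 : ℝ) τ, ∫⁻ x : T3, ENNReal.ofReal |Xtil σ r φ s (Φ.flow s z) x - Xdet σ Θ ū φ s x| := by
  -- joint measurability of the integrand along the orbit
  have hX := measurable_Xtil (N := N) hE hσ hσ3 hr hφ
  have hlift : Measurable fun p : ℝ × T3 => ((p.1, (Φ.flow p.1 z, p.2)) : ℝ × Phase N × T3) :=
    measurable_fst.prodMk (((measurable_flow_section Φ hz).comp measurable_fst).prodMk measurable_snd)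
  have hXo : Measurable fun p : ℝ × T3 => Xtil σ r φ p.1 (Φ.flow p.1 z) p.2 := by
    have h := hX.comp hlift
    simpa only [Function.comp_def] using h
  have hsec : ∀ s : ℝ, Measurable fun x : T3 => Xtil σ r φ s (Φ.flow s z) x := by
    intro s
    have h := hXo.comp (measurable_prodMk_left (x := s))
    simpa only [Function.comp_def] using h
  set A : ℝ → ℝ := fun s => ∫ x : T3, Xtil σ r φ s (Φ.flow s z) x with hAdef
  set Bd : ℝ → ℝ := fun s => ∫ x : T3, Xdet σ Θ ū φ s x with hBdef
  -- the inner bound at each time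
  have hinner : ∀ s, ENNReal.ofReal |A s - Bd s| ≤
      ∫⁻ x : T3, ENNReal.ofReal |Xtil σ r φ s (Φ.flow s z) x - Xdet σ Θ ū φ s x| := fun s =>
    ofReal_abs_sub_integral_le (hsec s).aestronglyMeasurable (integrable_Xdet σ Θ ū hφ s)
  -- the outer bound in time
  have hSM : StronglyMeasurable (Function.uncurry fun (s : ℝ) (x : T3) => Xtil σ r φ s (Φ.flow s z) x) :=
    hXo.stronglyMeasurable
  have hA : AEStronglyMeasurable A ((volume : Measure ℝ).restrict (Set.Icc (0 : ℝ) τ)) :=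
    (hSM.integral_prod_right' (ν := (volume : Measure T3))).aestronglyMeasurable
  have hB : Integrable Bd ((volume : Measure ℝ).restrict (Set.Icc (0 : ℝ) τ)) :=
    (continuous_integral_Xdet σ Θ ū hφ).integrableOn_Icc
  have houter := ofReal_abs_sub_integral_le hA hB
  have key : Itil σ r τ φ Φ z - Idet σ Θ ū τ φ = (∫ s in Set.Icc (0 : ℝ) τ, A s) - ∫ s in Set.Icc (0 : ℝ) τ, Bd s := rfl
  rw [key]
  exact houter.trans (lintegral_mono fun s => hinner s)

end TimeAvg

/-- **Reshaped registered stub `eq_timeAverage`** (line `exact-entropy-ledger-three-passivities`, equilibrium side composition; lead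
c3): for every `N` and flow there is a measurable `g` with `|Ĩ − I_det| ≤ g` almost surely under the homogeneous law and
`E[g] ≤ ∫₀^τ ∫_{𝕋³} E|X̃(s,·,x) − X_det(s,x)| dx ds` (Tonelli through the measurable modification of the flow, then invariance
of the homogeneous law at each fixed `(s, x)`). -/
theorem eq_timeAverage : ∀ (η₀ : ℝ) (F : ℝ → ℝ), EosBand η₀ F → ∀ (a Θ σ r τ : ℝ) (ū : V3) (φ : ℝ → T3 → ℝ), 0 < a → 0 < Θ → 0 < σ → σ ≤ 1 / 2 → 3 * σ ^ 3 < η₀ → 0 < r → 0 < τ → Literature.Analysis.FunctionSpaces.Torus.IsSmoothSpaceTimeOn Set.univ φ → ∀ (N : ℕ) (Φ : Flow σ N), ∃ g : Phase N → ℝ≥0∞, Measurable g ∧ (∀ᵐ z ∂(lawC σ a Θ ū N Φ), ENNReal.ofReal |Itil σ r τ φ Φ z - Idet σ Θ ū τ φ| ≤ g z) ∧ ∫⁻ z, g z ∂(lawC σ a Θ ū N Φ) ≤ ∫⁻ s in Set.Icc (0 : ℝ) τ, ∫⁻ x : T3, ∫⁻ w, ENNReal.ofReal |Xtil σ r φ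 s w x - Xdet σ Θ ū φ s x| ∂(lawC σ a Θ ū N Φ) := by
  intro η₀ F hE a Θ σ r τ ū φ ha hΘ hσ hσhalf hσ3 hr _hτ hφ N Φ
  haveI : IsProbabilityMeasure (lawC σ a Θ ū N Φ) :=
    isProbabilityMeasure_localGibbsLaw continuous_const continuous_const continuous_const
      (fun _ => ha) (fun _ => hΘ) hσhalf N Φ
  -- the jointly measurable deviation and its pull-back through the measurable modification of the flow
  set D : ℝ × Phase N × T3 → ℝ≥0∞ := fun q => ENNReal.ofReal |Xtil σ r φ q.1 q.2.1 q.2.2 - Xdet σ Θ ū φ q.1 q.2.2|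
    with hD
  have hDm : Measurable D := TimeAvg.measurable_absDev (N := N) ū hE hσ hσ3 hr hφ
  set K : (Phase N × ℝ) × T3 → ℝ≥0∞ := fun q => D (q.1.2, flowReg Φ q.1, q.2) with hK
  have hKm : Measurable K :=
    hDm.comp ((measurable_snd.comp measurable_fst).prodMk (((measurable_flowReg Φ).comp measurable_fst).prodMk measurable_snd))
  -- H (z, s) := ∫⁻ x, K ((z, s), x) and g z := ∫⁻ s in Icc, H (z, s)
  have hHm : Measurable fun p : Phase N × ℝ => ∫⁻ x : T3, K (p, x) := hKm.lintegral_prod_right'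
  set g : Phase N → ℝ≥0∞ := fun z => ∫⁻ s in Set.Icc (0 : ℝ) τ, ∫⁻ x : T3, K ((z, s), x) with hg
  have hgm : Measurable g := by
    have h := (hHm.lintegral_prod_right' (ν := (volume : Measure ℝ).restrict (Set.Icc (0 : ℝ) τ)))
    exact h
  refine ⟨g, hgm, ?_, ?_⟩
  · -- a.e. bound: on the good set the modification is the flow
    have hac : lawC σ a Θ ū N Φ ≪ liouville (Torus.geometry (Fin 3)) (N + 1) (hsDiameter σ N) :=
      withDensity_absolutelyContinuous _ _
    have hgood : ∀ᵐ z ∂(lawC σ a Θ ū N Φ), z ∈ Φ.good := hac.ae_le Φ.ae_mem_good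
    filter_upwards [hgood] with z hz
    have h := TimeAvg.ofReal_abs_Itil_sub_Idet_le (N := N) (τ := τ) (Θ := Θ) ū hE hσ hσ3 hr hφ Φ hz
    refine h.trans (le_of_eq ?_)
    simp only [hg, hK, hD, flowReg_of_mem Φ hz]
  · -- Tonelli twice, then invariance at fixed (s, x)
    have hswap1 : ∫⁻ z, g z ∂(lawC σ a Θ ū N Φ) =
        ∫⁻ s in Set.Icc (0 : ℝ) τ, ∫⁻ z, (∫⁻ x : T3, K ((z, s), x)) ∂(lawC σ a Θ ū N Φ) := by
      simp only [hg]
      have h1 : AEMeasurable (Function.uncurry fun (z : Phase N) (s : ℝ) => ∫⁻ x : T3, K ((z, s), x))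
          ((lawC σ a Θ ū N Φ).prod ((volume : Measure ℝ).restrict (Set.Icc (0 : ℝ) τ))) := hHm.aemeasurable
      exact lintegral_lintegral_swap h1
    have hswap2 : ∀ s, ∫⁻ z, (∫⁻ x : T3, K ((z, s), x)) ∂(lawC σ a Θ ū N Φ) =
        ∫⁻ x : T3, ∫⁻ z, K ((z, s), x) ∂(lawC σ a Θ ū N Φ) := by
      intro s
      have hm : Measurable fun q : Phase N × T3 => K ((q.1, s), q.2) :=
        hKm.comp ((measurable_fst.prodMk measurable_const).prodMk measurable_snd)
      have h2 : AEMeasurable (Function.uncurry fun (z : Phase N) (x : T3) => K ((z, s), x))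
          ((lawC σ a Θ ū N Φ).prod (volume : Measure T3)) := hm.aemeasurable
      exact lintegral_lintegral_swap h2
    have hinv : ∀ s (x : T3), ∫⁻ z, K ((z, s), x) ∂(lawC σ a Θ ū N Φ) =
        ∫⁻ w, ENNReal.ofReal |Xtil σ r φ s w x - Xdet σ Θ ū φ s x| ∂(lawC σ a Θ ū N Φ) := by
      intro s x
      have hac : lawC σ a Θ ū N Φ ≪ liouville (Torus.geometry (Fin 3)) (N + 1) (hsDiameter σ N) :=
        withDensity_absolutelyContinuous _ _
      have hgood : ∀ᵐ z ∂(lawC σ a Θ ū N Φ), z ∈ Φ.good := hac.ae_le Φ.ae_mem_good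
      have hae : (fun z => K ((z, s), x)) =ᵐ[lawC σ a Θ ū N Φ] fun z => D (s, Φ.flow s z, x) := by
        filter_upwards [hgood] with z hz
        simp only [hK, flowReg_of_mem Φ hz]
      have hsec : Measurable fun w : Phase N => D (s, w, x) :=
        hDm.comp (measurable_const.prodMk (measurable_id.prodMk measurable_const))
      rw [lintegral_congr_ae hae]
      exact Summit.AtomisticToContinuum.HydrodynamicLimit.Theorems.lintegral_comp_flow_localGibbsLaw_const
        σ a Θ ū N Φ s hsec
    rw [hswap1]
    refine le_of_eq (setLIntegral_congr_fun measurableSet_Icc fun s _ => ?_)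
    rw [hswap2 s]
    exact lintegral_congr fun x => hinv s x

end Summit.AtomisticToContinuum.HydrodynamicLimit.Theorems.LocalSecondLawEquilibrium

end
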